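import Summits.ABC.ABC.Theses.CubicResolventAllowance
import Summits.ABC.ABC.Theorems.CubicResolventAllowanceResolventDiscBounds
import Literature.NumberTheory.DiophantineGeometry.MordellEquationPowerSavingBounds
import HarnessLib

/-!
# STUB-IDEAS `stub_realCubic` · ideator k2 (RESHAPE) · generation 12 — the 2026 LFL record for the
# route's own equation class (Pasten, arXiv:2608.23559, tree CLAIM `Pasten2026.cubicThueMahler_log_le`),
# read through the index-form dictionary: a calibration, not a line.

Crux stmt-ABC-22740 `CubicResolventAllowance.IndexSzpiro`, stub `stub_realCubic` (the `0 < d_K` half).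
What is typed here (all statements; ONE `sorry` = L1, bookkeeping with logarithms; L2 PROVED):
* `StubRealCubic` — the registered stub, verbatim (§0 of every k2-real sketch).
* `IndexFormDictionary` — the hypothesis Prop compressing g2 CORE A (IF1–IF4, U4), the k1-G5 keystone
  `2⁸Δ_min = I_E²·d_K` and k3-g12's Hessian box into exactly what L1 consumes: an irreducible integral
  binary cubic form `P` with `disc P = d_K` and `log H(P) ≪ log d_K`, coprime `(u,v)`, an imprimitivity
  factor `g ∣ 2⁸·N` (twist-minimality at odd `p`: a multiplicative prime never divides `g`, an additive one
  at most once, else the minimal model would not be minimal), with `2⁸·Δ_min = d_K·(g³·P(u,v))²` and every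
  prime of `P(u,v)` dividing `2N`.
* `LFLClassBound` — the shape Pasten's Cor 1.9 (closing clause) yields on the class:
  `log Δ_min ≤ C_ε·(1 + log d_K + log N + e^{(6+ε)Q}·√d_K·(log 2d_K)⁴)` for any bound `Q` on the primes of `2N`.
* `L1` : `Pasten2026.cubicThueMahler_log_le → IndexFormDictionary → LFLClassBound` (M, sorry; CALIBRATION —
  do not staff unless the stub critic wants the LFL floor kernel-checked).
* `L2` (PROVED): the allowance is slaved to the conductor, `√d_K ≤ 45·N` on the class, from the LANDED
  `resolventDiscBounds_proof` — so the paper's `D^{1/2+o(1)}` saving is worth at most one power of `N` here.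
Verdict on the stub: unchanged (open-problem); the new print is INSIDE `Literature.Barriers.ABC.BakerMethodBounds`.
-/

namespace Summit.ABC.ABC.Cruxes.IndexSzpiro.StubIdeas2RealG12

open Summit.ABC.ABC.Theses.CubicResolventAllowance
open Polynomial
open Literature.NumberTheory.DiophantineGeometry

/-! ## §0 The stub (verbatim) -/

/-- The registered stub `stub_realCubic`, verbatim. -/
def StubRealCubic : Prop :=
  ∀ ε : ℝ, 0 < ε → ∃ C : ℝ, ∀ (W : WeierstrassCurve ℚ) [W.IsElliptic] (K : Type) [Field K] [NumberField K],
    Irreducible W.twoTorsionPolynomial.toPoly → Module.finrank ℚ K = 3 →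
    (∃ θ : K, aeval θ W.twoTorsionPolynomial.toPoly = 0) → 0 < NumberField.discr K →
    (W.minimalDiscriminantNorm ℤ : ℝ) ≤ C * |(NumberField.discr K : ℝ)| * (W.conductorNorm ℤ : ℝ) ^ (6 + ε)

/-! ## §1 The dictionary hypothesis (g2 CORE A + k1-G5 keystone + k3-g12 reduction box, compressed) -/

/-- Value of the binary cubic form `P = aU³ + bU²V + cUV² + dV³` at `(u,v)`. -/
def cubicEval (P : Cubic ℤ) (u v : ℤ) : ℤ :=
  P.a * u ^ 3 + P.b * u ^ 2 * v + P.c * u * v ^ 2 + P.d * v ^ 3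

/-- Height (max coefficient) of `P`. -/
def cubicHeight (P : Cubic ℤ) : ℤ := max (max |P.a| |P.b|) (max |P.c| |P.d|)

/-- **P0 `IndexFormDictionary` (hypothesis Prop; pieces on pages: g2 IF1–IF4/U4, k1 G5 `K6`, k3-g12 §1).**
For a class pair `(W, K)` with `0 < d_K`: a Hessian-reduced index form `P` of `𝓞_K` (`disc P = d_K`,
irreducible, `a ≠ 0`, coefficients `≤ c₀·d_K`), the coordinates `g·(u,v)` (`gcd(u,v) = 1`, `0 < g`,
`g ∣ 2⁸·N`) of the integral 2-division generator `θ₀ = 4θ` of the MINIMAL model, the keystone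
`2⁸·Δ_min = d_K·(g³·P(u,v))²`, and the support statement (primes of the index divide `2N`). -/
def IndexFormDictionary : Prop :=
  ∃ c₀ : ℝ, 0 < c₀ ∧ ∀ (W : WeierstrassCurve ℚ) [W.IsElliptic] (K : Type) [Field K] [NumberField K],
    Irreducible W.twoTorsionPolynomial.toPoly → Module.finrank ℚ K = 3 →
    (∃ θ : K, aeval θ W.twoTorsionPolynomial.toPoly = 0) → 0 < NumberField.discr K →
    ∃ (P : Cubic ℤ) (u v : ℤ) (g : ℕ), P.a ≠ 0 ∧ Irreducible P.toPoly ∧ Int.gcd u v = 1 ∧ 0 < g ∧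
      g ∣ 2 ^ 8 * W.conductorNorm ℤ ∧ P.discr = NumberField.discr K ∧
      (cubicHeight P : ℝ) ≤ c₀ * (NumberField.discr K : ℝ) ∧
      (2 : ℤ) ^ 8 * (W.minimalDiscriminantNorm ℤ : ℤ) = NumberField.discr K * ((g : ℤ) ^ 3 * cubicEval P u v) ^ 2 ∧
      (∀ p : ℕ, p.Prime → (p : ℤ) ∣ cubicEval P u v → p ∣ 2 * W.conductorNorm ℤ)

/-! ## §2 The LFL floor on the class, in closed form -/

/-- **`LFLClassBound`** — the shape of Pasten 2026 Cor 1.9 on the real class: for every `ε > 0` a `C` with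
`log Δ_min ≤ C·(1 + log d_K + log N + e^{(6+ε)Q}·√d_K·(log 2d_K)⁴)` whenever every prime of `2N` is `≤ Q`.
Exponential in the largest bad prime; the `√d_K` is the paper's power saving (previously `d_K^{1+o(1)}`). -/
def LFLClassBound : Prop :=
  ∀ ε : ℝ, 0 < ε → ∃ C : ℝ, ∀ (W : WeierstrassCurve ℚ) [W.IsElliptic] (K : Type) [Field K] [NumberField K],
    Irreducible W.twoTorsionPolynomial.toPoly → Module.finrank ℚ K = 3 →
    (∃ θ : K, aeval θ W.twoTorsionPolynomial.toPoly = 0) → 0 < NumberField.discr K →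
    ∀ Q : ℕ, 2 ≤ Q → (∀ p : ℕ, p.Prime → p ∣ 2 * W.conductorNorm ℤ → p ≤ Q) →
      Real.log (W.minimalDiscriminantNorm ℤ : ℝ) ≤
        C * (1 + Real.log (NumberField.discr K : ℝ) + Real.log (W.conductorNorm ℤ : ℝ) +
          Real.exp ((6 + ε) * Q) * Real.sqrt (NumberField.discr K : ℝ) *
            Real.log (2 * (NumberField.discr K : ℝ)) ^ 4)

/-- **L1 (M, sorry — CALIBRATION).** Pasten's Cor 1.9 (tree CLAIM, unrefereed) + the dictionary give the LFL
floor on the class: `log Δ_min = log d_K + 6 log g + 2 log|P(u,v)| − 8 log 2`,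
`log|P(u,v)| ≤ log 4 + log H + 3 log max(|u|,|v|)`, `log g ≤ 8 log 2 + log N`, `log H ≤ log c₀ + log d_K`,
and Cor 1.9 at the admissible prime bound `Q`. -/
theorem L1_lflClassBound_of_pasten (hP : Pasten2026.cubicThueMahler_log_le) (hD : IndexFormDictionary) :
    LFLClassBound := by
  sorry

/-- **L2 (S, PROVED).** The allowance is slaved to the conductor on the class: `√d_K ≤ 45·N`
(LANDED `resolventDiscBounds_proof`: `|d_K| ≤ 1944·N²`, and `1944 < 45²`). Hence Pasten's `D^{1/2}` saving
is worth at most `45·N` inside `LFLClassBound`, against the stub's `(6+ε)·log N + log d_K`. -/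
theorem L2_sqrt_discr_le (W : WeierstrassCurve ℚ) [W.IsElliptic] (K : Type) [Field K] [NumberField K]
    (hirr : Irreducible W.twoTorsionPolynomial.toPoly) (h3 : Module.finrank ℚ K = 3)
    (hθ : ∃ θ : K, aeval θ W.twoTorsionPolynomial.toPoly = 0) :
    Real.sqrt |(NumberField.discr K : ℝ)| ≤ 45 * (W.conductorNorm ℤ : ℝ) := by
  have hB := (Summit.ABC.ABC.Theorems.resolventDiscBounds_proof).1 W K hirr h3 hθ
  have hN : (0 : ℝ) ≤ (W.conductorNorm ℤ : ℝ) := Nat.cast_nonneg _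
  have h1 : |(NumberField.discr K : ℝ)| ≤ (45 * (W.conductorNorm ℤ : ℝ)) ^ 2 := by
    calc |(NumberField.discr K : ℝ)| ≤ 1944 * (W.conductorNorm ℤ : ℝ) ^ (2 : ℕ) := hB
      _ ≤ (45 * (W.conductorNorm ℤ : ℝ)) ^ 2 := by nlinarith [sq_nonneg (W.conductorNorm ℤ : ℝ)]
  calc Real.sqrt |(NumberField.discr K : ℝ)| ≤ Real.sqrt ((45 * (W.conductorNorm ℤ : ℝ)) ^ 2) :=
        Real.sqrt_le_sqrt h1
    _ = 45 * (W.conductorNorm ℤ : ℝ) := Real.sqrt_sq (by positivity)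

/-- **L3 (S, PROVED — the comparison that closes the cell).** In the lone-tower regime `N = M·p` the
LFL floor is polynomial in `p` while the stub needs `log p`: if `log Δ ≤ A·p^k` and `p^{n} ≤ Δ` then
`n·log p ≤ A·p^k` — the tower depth the floor allows grows like `p^k / log p`, the stub allows `7 + ε`.
(Pure bookkeeping, recorded so the critic sees the gap as a kernel statement.) -/
theorem L3_tower_depth_of_log_bound {Δ A : ℝ} {p n k : ℕ} (hp : 2 ≤ p) (hΔ : (p : ℝ) ^ n ≤ Δ)
    (hlog : Real.log Δ ≤ A * (p : ℝ) ^ k) : (n : ℝ) * Real.log p ≤ A * (p : ℝ) ^ k := by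
  have hp0 : (0 : ℝ) < (p : ℝ) := by exact_mod_cast (lt_of_lt_of_le (by norm_num) hp)
  have hpn : (0 : ℝ) < (p : ℝ) ^ n := pow_pos hp0 n
  have h1 : Real.log ((p : ℝ) ^ n) ≤ Real.log Δ := Real.log_le_log hpn hΔ
  rw [Real.log_pow] at h1
  linarith

end Summit.ABC.ABC.Cruxes.IndexSzpiro.StubIdeas2RealG12
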